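/-
Origin: expansion seat `planner-pub-hodgecm-toy2-g5-0`, handover #8 2026-08-18T09:12:27Z (`HOME/pub-hodgecm-toy2-g5/lean/Toy2g5/ToyPadH0Fund.lean`, md5 1ff3b37f, 161 lines);
landed by the gen-7 packager in gate run 27 as `HodgeCM/Model/Toy/ToyPadH0Fund.lean` (import ^import Toy2g5\.PadH0Fund\b→import HodgeCM.Model.PadH0Fund ×1; stripped 3 #print/#check/#eval lines).
-/
/-
Copyright: pub-hodgecm formalisation cell (harness21, 2026). New file (not vendored).
Origin: HOME/pub-hodgecm-toy2-g5/lean/Toy2g5/ToyPadH0Fund.lean — session planner-pub-hodgecm-toy2-g5-0 (unit pub-hodgecm-toy2-g5,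
CONSISTENCY seat 2, part (6a)(ii), generation 5).  WIP module `Toy2g5.ToyPadH0Fund`; intended final place
`HodgeCM/Model/Toy/ToyPadH0Fund.lean` (module `HodgeCM.Model.Toy.ToyPadH0Fund`).  ONE import to rewrite on landing:
`Toy2g5.PadH0Fund` ↦ `HodgeCM.Model.PadH0Fund`.
-/
import Summits.HodgeConjecture.HodgeCM.Model.PadH0Fund
import Summits.HodgeConjecture.HodgeCM.Model.Toy.H0Rank
import Summits.HodgeConjecture.HodgeCM.Model.Toy.ToyGysinDescent
import Summits.HodgeConjecture.HodgeCM.Model.Toy.ToyFFacts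
import Summits.HodgeConjecture.HodgeCM.Model.Toy.ToyOpenInputs
import Summits.HodgeConjecture.HodgeCM.Model.Toy.TruncAlgMilne
import Summits.HodgeConjecture.HodgeCM.Model.ToyPerL

/-!
# N5 `Fact_fundClass` and the degree-0 residue `Qw8MilneZero` are independent: the model `toyModel♭⁰`

`h0PadModel := toyModel.padH0 toyModel.padDatumH0` (`HodgeCM.Model.PadH0Fund` on the exterior toy universe).  Truth table
(each row a theorem below or in the files cited):

| statement                                        | `toyModel` | `h0PadModel` |
|--------------------------------------------------|:----------:|:------------:|
| `ModelAxioms` (M1–M28), `Fact_dimProd`, `W_RK4`  | true       | true         |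
| N1, N2, N3, N4, F4, F5                           | true       | true         |
| `PohlmannSpan`, `Qw8MilnePos`                    | true       | true         |
| **N5 `Fact_fundClass`**                          | true       | **false**    |
| **`Qw8MilneZero`**, `Qw8Milne`                   | true       | **false**    |
| **`HC_CM`** (COR-CM)                             | true       | **false**    |

Headlines: `HodgeCM.Toy.fact_fundClass_independent`, `HodgeCM.Toy.qw8MilneZero_independent` — N5 and the degree-0 residue of
[QW8] Thm 2.5 are independent of `ModelAxioms ∧ N1 ∧ N2 ∧ N3 ∧ N4 ∧ F4 ∧ F5 ∧ Fact_dimProd ∧ W_RK4 ∧ PohlmannSpan ∧ Qw8MilnePos`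
(both truth values realised).  Nothing is cited; Lean + Mathlib axioms only.
-/

noncomputable section

namespace HodgeCM.Toy

open Literature.AlgebraicGeometry.Motives (CMType HodgeStructure)
open Universe

/-- **N5 `Fact_fundClass` holds in `toyModel`**: `Alg := Hdg` and `H⁰ = ⋀⁰` has `F⁰ = ⊤` (N4 in the toy). -/
theorem toyModel_fact_fundClass : toyModel.Fact_fundClass := fun X =>
  eq_top_iff.mpr fun v _ =>
    (HodgeStructure.mem_hodgeClasses_iff (exteriorHodgeData.hs X (2 * 0)) ((0 : ℕ) : ℤ) v).mpr (by
      have hF : (exteriorHodgeData.hs X (2 * 0)).F ((0 : ℕ) : ℤ) = ⊤ := toyModel_fact_hodge_F0 X (2 * 0)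
      rw [hF]; exact Submodule.mem_top)

/-- `Qw8MilnePos` holds in `toyModel` (from `Qw8Milne`, `toyModel_qw8Milne_of_descent`); `Qw8MilneZero` is
`toyModel_qw8MilneZero` of `HodgeCM.Model.Toy.TruncAlgMilne`. -/
theorem toyModel_qw8MilnePos : toyModel.Qw8MilnePos := qw8MilnePos_of_qw8Milne toyModel_qw8Milne_of_descent

/-- **The `H⁰`-padded toy universe** `toyModel♭⁰`: `H⁰(X) ↦ H⁰(X) ⊕ H⁰(X)`, the pad of type `(0,0)`, invisible to `Alg`, cup
and traces. -/
def h0PadModel : Universe := toyModel.padH0 toyModel.padDatumH0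

/-- (Ported verbatim from the HodgeCMPerL package; no docstring in the source.) -/
theorem h0PadModel_def : h0PadModel = toyModel.padH0 toyModel.padDatumH0 := rfl

/-- (Ported verbatim from the HodgeCMPerL package; no docstring in the source.) -/
theorem h0PadModel_modelAxioms : h0PadModel.ModelAxioms := PadH0Fund.modelAxioms toyModel_modelAxioms toyModel_fact_dimProd

/-- (Ported verbatim from the HodgeCMPerL package; no docstring in the source.) -/
theorem h0PadModel_fact_cupExterior : h0PadModel.Fact_cupExterior :=
  PadH0Fund.fact_cupExterior_iff.mpr toyModel_fact_cupExterior

/-- (Ported verbatim from the HodgeCMPerL package; no docstring in the source.) -/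
theorem h0PadModel_fact_cup_hodge : h0PadModel.Fact_cup_hodge := PadH0Fund.fact_cup_hodge toyModel_fact_cup_hodge

/-- (Ported verbatim from the HodgeCMPerL package; no docstring in the source.) -/
theorem h0PadModel_fact_pull_H0 : h0PadModel.Fact_pull_H0 := PadH0Fund.fact_pull_H0_iff.mpr toyModel_fact_pull_H0

/-- (Ported verbatim from the HodgeCMPerL package; no docstring in the source.) -/
theorem h0PadModel_fact_hodge_F0 : h0PadModel.Fact_hodge_F0 := PadH0Fund.fact_hodge_F0_iff.mpr toyModel_fact_hodge_F0

/-- (Ported verbatim from the HodgeCMPerL package; no docstring in the source.) -/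
theorem h0PadModel_fact_cupAlg : h0PadModel.Fact_cupAlg := PadH0Fund.fact_cupAlg fact_cupAlg

/-- (Ported verbatim from the HodgeCMPerL package; no docstring in the source.) -/
theorem h0PadModel_fact_cupAssoc : h0PadModel.Fact_cupAssoc := PadH0Fund.fact_cupAssoc (fact_cupAssoc exteriorHodgeData)

/-- (Ported verbatim from the HodgeCMPerL package; no docstring in the source.) -/
theorem h0PadModel_fact_dimProd : h0PadModel.Fact_dimProd := PadH0Fund.fact_dimProd_iff.mpr toyModel_fact_dimProd

/-- (Ported verbatim from the HodgeCMPerL package; no docstring in the source.) -/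
theorem h0PadModel_w_rk4 : h0PadModel.W_RK4 := PadH0Fund.w_RK4_iff.mpr toyModel_w_rk4

/-- (Ported verbatim from the HodgeCMPerL package; no docstring in the source.) -/
theorem h0PadModel_pohlmannSpan : h0PadModel.PohlmannSpan :=
  PadH0Fund.pohlmannSpan toyModel_modelAxioms toyModel_fact_dimProd toyModel_fact_cupExterior toyModel_fact_cup_hodge
    toyModel_fact_pull_H0 toyModel_fact_hodge_F0

/-- (Ported verbatim from the HodgeCMPerL package; no docstring in the source.) -/
theorem h0PadModel_qw8MilnePos : h0PadModel.Qw8MilnePos :=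
  PadH0Fund.qw8MilnePos toyModel_modelAxioms toyModel_fact_dimProd toyModel_fact_cupExterior toyModel_fact_cup_hodge
    toyModel_fact_pull_H0 toyModel_fact_hodge_F0 fact_cupAlg (fact_cupAssoc exteriorHodgeData)

/-- **N5 fails in `toyModel♭⁰`.** -/
theorem not_h0PadModel_fact_fundClass : ¬ h0PadModel.Fact_fundClass :=
  PadH0Fund.not_fact_fundClass (cmProdH0Nontrivial exteriorHodgeData)

/-- **The degree-0 residue `Qw8MilneZero` fails in `toyModel♭⁰`.** -/
theorem not_h0PadModel_qw8MilneZero : ¬ h0PadModel.Qw8MilneZero :=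
  PadH0Fund.not_qw8MilneZero toyModel_fact_pull_H0 (cmProdH0Nontrivial exteriorHodgeData)

/-- (Ported verbatim from the HodgeCMPerL package; no docstring in the source.) -/
theorem not_h0PadModel_qw8Milne : ¬ h0PadModel.Qw8Milne :=
  PadH0Fund.not_qw8Milne toyModel_fact_pull_H0 (cmProdH0Nontrivial exteriorHodgeData)

/-- **COR-CM fails in `toyModel♭⁰`.** -/
theorem not_h0PadModel_hc_cm : ¬ h0PadModel.HC_CM :=
  PadH0Fund.not_hc_cm toyModel_modelAxioms (cmProdH0Nontrivial exteriorHodgeData)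

/-- The full profile of `toyModel♭⁰`. -/
theorem h0PadModel_profile :
    h0PadModel.ModelAxioms ∧ h0PadModel.Fact_dimProd ∧ h0PadModel.Fact_cupExterior ∧ h0PadModel.Fact_cup_hodge ∧
      h0PadModel.Fact_pull_H0 ∧ h0PadModel.Fact_hodge_F0 ∧ h0PadModel.Fact_cupAlg ∧ h0PadModel.Fact_cupAssoc ∧
      h0PadModel.W_RK4 ∧ h0PadModel.PohlmannSpan ∧ h0PadModel.Qw8MilnePos ∧
      ¬ h0PadModel.Fact_fundClass ∧ ¬ h0PadModel.Qw8MilneZero ∧ ¬ h0PadModel.Qw8Milne ∧ ¬ h0PadModel.HC_CM :=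
  ⟨h0PadModel_modelAxioms, h0PadModel_fact_dimProd, h0PadModel_fact_cupExterior, h0PadModel_fact_cup_hodge,
    h0PadModel_fact_pull_H0, h0PadModel_fact_hodge_F0, h0PadModel_fact_cupAlg, h0PadModel_fact_cupAssoc, h0PadModel_w_rk4,
    h0PadModel_pohlmannSpan, h0PadModel_qw8MilnePos, not_h0PadModel_fact_fundClass, not_h0PadModel_qw8MilneZero,
    not_h0PadModel_qw8Milne, not_h0PadModel_hc_cm⟩

/-- The list of statements both models satisfy. -/
def FundContext (U : Universe) : Prop :=
  U.ModelAxioms ∧ U.Fact_cupExterior ∧ U.Fact_cup_hodge ∧ U.Fact_pull_H0 ∧ U.Fact_hodge_F0 ∧ U.Fact_cupAlg ∧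
    U.Fact_cupAssoc ∧ U.Fact_dimProd ∧ U.W_RK4 ∧ U.PohlmannSpan ∧ U.Qw8MilnePos

/-- (Ported verbatim from the HodgeCMPerL package; no docstring in the source.) -/
theorem toyModel_fundContext : FundContext toyModel :=
  ⟨toyModel_modelAxioms, toyModel_fact_cupExterior, toyModel_fact_cup_hodge, toyModel_fact_pull_H0, toyModel_fact_hodge_F0,
    fact_cupAlg, fact_cupAssoc exteriorHodgeData, toyModel_fact_dimProd, toyModel_w_rk4, toyModel_pohlmannSpan',
    toyModel_qw8MilnePos⟩

/-- (Ported verbatim from the HodgeCMPerL package; no docstring in the source.) -/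
theorem h0PadModel_fundContext : FundContext h0PadModel :=
  ⟨h0PadModel_modelAxioms, h0PadModel_fact_cupExterior, h0PadModel_fact_cup_hodge, h0PadModel_fact_pull_H0,
    h0PadModel_fact_hodge_F0, h0PadModel_fact_cupAlg, h0PadModel_fact_cupAssoc, h0PadModel_fact_dimProd, h0PadModel_w_rk4,
    h0PadModel_pohlmannSpan, h0PadModel_qw8MilnePos⟩

/-- **N5 `Fact_fundClass` is INDEPENDENT of `ModelAxioms ∧ N1 ∧ N2 ∧ N3 ∧ N4 ∧ F4 ∧ F5 ∧ Fact_dimProd ∧ W_RK4 ∧ PohlmannSpan ∧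
Qw8MilnePos`**: both truth values are realised (`toyModel`: true; `toyModel♭⁰`: false). -/
theorem fact_fundClass_independent :
    (∃ U : Universe, FundContext U ∧ U.Fact_fundClass) ∧ (∃ U : Universe, FundContext U ∧ ¬ U.Fact_fundClass) :=
  ⟨⟨toyModel, toyModel_fundContext, toyModel_fact_fundClass⟩, ⟨h0PadModel, h0PadModel_fundContext, not_h0PadModel_fact_fundClass⟩⟩

/-- **The degree-0 residue `Qw8MilneZero` is INDEPENDENT of the same list** (`toyModel`: true; `toyModel♭⁰`: false) — no binder
of the certified [QW8]-side assembly short of `Fact_fundClass` / `Fact_unitH0` / Gysin descent yields an algebraic class of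
degree `0`. -/
theorem qw8MilneZero_independent :
    (∃ U : Universe, FundContext U ∧ U.Qw8MilneZero) ∧ (∃ U : Universe, FundContext U ∧ ¬ U.Qw8MilneZero) :=
  ⟨⟨toyModel, toyModel_fundContext, toyModel_qw8MilneZero⟩, ⟨h0PadModel, h0PadModel_fundContext, not_h0PadModel_qw8MilneZero⟩⟩

/-- COR-CM is not a consequence of that list either (cf. the cup-closed honest model `lefModel` of the qw8 lineage, which
shows more: COR-CM is independent of ALL generic [QW8]-side facts). -/
theorem not_hc_cm_of_fundContext : ¬ ∀ U : Universe, FundContext U → U.HC_CM :=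
  fun h => not_h0PadModel_hc_cm (h h0PadModel h0PadModel_fundContext)

/-- (Ported verbatim from the HodgeCMPerL package; no docstring in the source.) -/
theorem not_fact_fundClass_of_fundContext : ¬ ∀ U : Universe, FundContext U → U.Fact_fundClass :=
  fun h => not_h0PadModel_fact_fundClass (h h0PadModel h0PadModel_fundContext)

/-- (Ported verbatim from the HodgeCMPerL package; no docstring in the source.) -/
theorem not_qw8MilneZero_of_fundContext : ¬ ∀ U : Universe, FundContext U → U.Qw8MilneZero :=
  fun h => not_h0PadModel_qw8MilneZero (h h0PadModel h0PadModel_fundContext)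

/-- (Ported verbatim from the HodgeCMPerL package; no docstring in the source.) -/
theorem h0PadModel_ne_toyModel : h0PadModel ≠ toyModel :=
  fun h => not_h0PadModel_fact_fundClass (h ▸ toyModel_fact_fundClass)


end HodgeCM.Toy

end
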